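import Summits.QuantumFields.YangMills.Theorems.UnitScaleTiltProp7TrueLinDefectBound
import HarnessLib

/-!
# Route `UnitScaleTilt`, crux K1 «MinimiserStabilityRegPr» (stmt-QuantumFields-19200), route-R [RP] curved, row (n3) N3b, file 1a —
# THE ONE-LEVEL `ℓ¹` ROWS OF THE REDUCED TRUE LINEARISATION: `‖LINE_j‖_{ℓ¹→ℓ¹} ≤ L^{1−d}`, `‖Def_j‖_{ℓ¹→ℓ¹} ≤ 159a_j(d+2)L·2d` (NO volume factor),
# `‖CM_j‖_{ℓ¹(bonds)→ℓ¹(sites)} ≤ (d+2)L`, and the real bookkeeping of a sourced contraction with an initial value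

Cell `ym3-torus`, D-0154 (3c) extra-width seat `ym-routeR-w6` (gen 3); first half of the `ℓ¹` TWIN of ★routeR-w3's ✓ `…Prop7TrueLinSourcedDefect` (file A2, `ℓ²`),
written for row (n3) N3b of the route-R door (★routeR-w1 g2's located hand-over 2026-08-28 12:53Z: «the k-uniform road is the STRUCTURE recursion in `ℓ¹` — the
LINE share contracts by `L^{1−d}` per level, the coarse-gauge share is carried without growth»).  THEOREMS ONLY (0 `def`, 0 `sorry`); `--supports stmt-QuantumFields-19200`,
count-neutral.  YM₃ on T³ is a ladder rung (R3), not the Clay problem; nothing here claims the stub, the crux, d = 4 or the mass gap.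

THE POINT.  The door's third supplier (★p1 g13 12:50Z (c), ★w4-19200 g4's JOINT ROW) pairs the multiplier `λ` of ✓ `…Prop7FirstVariationExactPairing` ∕
`…MultiplierBound` (`‖λ‖_∞ ≤ 2ε₀ℓ⁻¹`) with the `ℓ¹` size of the accumulated two-point remainder of the nonlinear (0.4)-fibre, so the tower transport of the per-level
remainders (N3a ✓ `…Prop7FibreRemainderL1Level`) must be done in `ℓ¹`, k-uniformly.  A plain operator norm `‖T_j‖_{ℓ¹→ℓ¹} ≈ 2d + L^{1−d}` exponentiates in `k`; the
structure split of ✓ `…TrueLinSourcedStructure` (`G^D_{j+1} = LINE_j G^D_j + Def_j G^D_j + R_j`, `Λ^D_{j+1} = CM_j G^D_j + Λ^D_j∘emb`) does not, because of the three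
one-level `ℓ¹` rows of this file: the line mean is a weight-`L^{−d}` average over an `L`-to-one family (✓ `Prop7TrueLinLineBound.norm_line_le` + `sum_coarse_offsets_shifts`),
the defect is `≤ 159a_j(d+2)L` times the two-block neighbourhood sum whose multiplicity is `2d` (✓ `Prop7TrueLinDefectBound.norm_defect_le_nbhd` + `sum_nbhd_le`), and the
covariant comb mean reads only the bonds of its own block (✓ `blockOf_src_of_mem_walk_stairWord`).  §3 is the real-sequence bookkeeping the tower file (1b,
✓∕⧗ `…Prop7TrueLinSourcedDefectL1`) consumes: the sourced contraction WITH AN INITIAL VALUE (the door reads `r(D) = −Q^{(k)}(iD)` through `D′_j := Y_j − Q^{(j)}(iD)`,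
`D′_0 = e^{iD} − 1 − iD ≠ 0`), the level sum of the geometric weights, and its k-uniform reading.

WHAT IS PROVED (ns `…Theorems.Prop7TrueLinSourcedDefectL1Rows`; `SU`-type background of any rank, any `P`, one level `j + 1 ≤ m + K`; `LINE`, `Def`, `CM` WRITTEN OUT as in
✓ p607412 ∕ A2).
* §1 ★ `sum_norm_line_le` (`Σ_c‖LINE_VZ(c)‖ ≤ (L^d)⁻¹L·Σ_b‖Z b‖`), ★ `sum_norm_defect_le` (`Σ_c‖Def_VZ(c)‖ ≤ 159α(d+2)L·2d·Σ_b‖Z b‖`).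
* §2 `mass_comb_block_le`, `norm_covCombMean_le_block`, ★ `sum_norm_covCombMean_le` (`Σ_z‖CM_VZ(z)‖ ≤ (d+2)L·Σ_b‖Z b‖`).
* §3 `sourced_recursion_bound_init` (`g_{j+1} ≤ (ρ+κa_j)g_j + r_j ⇒ g_k ≤ e^{(κ/ρ)Σa}(ρᵏg_0 + Σ_{j<k}ρ^{k−1−j}r_j)`), `sum_levels_geom_le`
  (`Σ_{j<k}(ρʲg₀ + Σ_{i<j}ρ^{j−1−i}r_i) ≤ (1−ρ)⁻¹(g₀ + Σ_{j<k}r_j)`), `geom_weights_uniform` (the k-uniform reading for `ρ ≤ 1/2`).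
HONEST SCOPE.  Bookkeeping over landed one-level bricks (✓ p606827 line, ✓ p607412 defect); nothing of [Balaban1984PropagatorsI] ∕ [Balaban1985Averaging] is asserted
beyond the cited tree theorems; no tower, no fibre, no curvature here.

References: T. Bałaban, CMP 95 (1984) 17–40 [Balaban1984PropagatorsI] ((1.11), (1.18)–(1.20) pp.19–20); CMP 98 (1985) 17–51 [Balaban1985Averaging] (Prop. 3
(124)–(126) p.36); CMP 109 (1987) 249–301 [Balaban1987RG1] ((0.3)–(0.4) pp.252–253).
-/

set_option autoImplicit false

noncomputable section

open scoped BigOperators Matrix.Norms.L2Operator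

namespace Summit.QuantumFields.YangMills.Theorems.Prop7TrueLinSourcedDefectL1Rows

open Literature.MathematicalPhysics.QuantumFieldTheory.Balaban1983to89
open Finset T4Continuum BlockAveraging AveragingRT ExpMeanLog BlockAveragingEMLLinearised BlockAveragingEMLLinearisedBackground BlockAveragingEMLProp2
open Summit.QuantumFields.YangMills.Theorems.Prop7TrueLinLineBound (norm_line_le sum_coarse_offsets_shifts)
open Summit.QuantumFields.YangMills.Theorems.Prop7TrueLinDefectBound (norm_defect_le_nbhd sum_nbhd_le blockOf_src_of_mem_walk_stairWord mass_le_length_mul)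
open Summit.QuantumFields.YangMills.Theorems.Prop7HolRatioPerStep (norm_covWalkSum_le_mass)

variable {P : Params} {n : Type*} [Fintype n] [DecidableEq n] [Nonempty n]

/-! ## §1 ★ The one-level `ℓ¹` rows: line mean and defect -/

/-- ★ **THE `ℓ¹` ROW OF THE COMB-TRANSPORTED STRAIGHT-LINE MEAN**: `Σ_c ‖LINE_VZ(c)‖ ≤ (L^d)⁻¹·L·Σ_b ‖Z(b)‖` (`= L^{1−d}·‖Z‖_{ℓ¹}`; `L⁻²` at d = 3), uniformly in the
level `j + 1 ≤ m + K` and in the background `V` — pointwise weight-`(L^d)⁻¹` bound (✓ `norm_line_le`) summed over the coarse bonds, then the `L`-to-one line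
reparametrisation (✓ `sum_coarse_offsets_shifts`). [cite: Balaban1984PropagatorsI, (1.11), (1.18) pp.19-20] -/
theorem sum_norm_line_le {j : ℕ} (hj : j + 1 ≤ P.m + P.K) (V : GaugeField P j (Matrix.specialUnitaryGroup n ℂ)) (Z : PBond P j → Matrix n n ℂ) :
    ∑ c : PBond P (j + 1), ‖((Fintype.card (Idx P) : ℂ))⁻¹ • ∑ i : Idx P,
        ((holAt V (walk (emb c.src) (stairWord i.2.1 (off i.1))) : Matrix.specialUnitaryGroup n ℂ) : Matrix n n ℂ) *
          covWalkSum V Z (walk (walkEnd (emb c.src) (stairWord i.2.1 (off i.1))) (List.replicate P.L (c.dir, true))) *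
        star ((holAt V (walk (emb c.src) (stairWord i.2.1 (off i.1))) : Matrix.specialUnitaryGroup n ℂ) : Matrix n n ℂ)‖
      ≤ ((P.L : ℝ) ^ P.d)⁻¹ * (P.L : ℝ) * ∑ b : PBond P j, ‖Z b‖ := by
  calc _ ≤ ∑ c : PBond P (j + 1), ((P.L : ℝ) ^ P.d)⁻¹ * ∑ r : Fin P.d → Fin P.L, ∑ t ∈ Finset.range P.L,
          ‖Z ⟨(fun z : Site P j => z.shift c.dir)^[t] (Site.blockSite c.src r), c.dir⟩‖ :=
        Finset.sum_le_sum fun c _ => norm_line_le V Z c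
    _ = ((P.L : ℝ) ^ P.d)⁻¹ * ((P.L : ℝ) * ∑ b : PBond P j, ‖Z b‖) := by
        rw [← Finset.mul_sum, sum_coarse_offsets_shifts hj (fun b : PBond P j => ‖Z b‖)]
    _ = _ := by ring

/-- ★ **THE `ℓ¹` DEFECT ROW OF ONE STEP**: if the (0.4) loop variables of `V` at every coarse bond are within `α ≤ 1/24` (`0 ≤ α < δ_N`) of `1`, then
`Σ_c ‖T(V)Z(c) − P_{V̄}(CM_VZ)(c) − LINE_VZ(c)‖ ≤ 159·α·(d+2)L·(2d)·Σ_b ‖Z(b)‖` — the pointwise defect against the two-block neighbourhood sum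
(✓ `norm_defect_le_nbhd`) and the multiplicity `≤ 2d` of a fine bond among the neighbourhoods (✓ `sum_nbhd_le`); NO volume factor `L^d` (unlike the `ℓ²` row).
[cite: Balaban1985Averaging, Prop. 3 (124)-(126) p.36] -/
theorem sum_norm_defect_le {j : ℕ} (hj : j + 1 ≤ P.m + P.K) (V : GaugeField P j (Matrix.specialUnitaryGroup n ℂ)) (Z : PBond P j → Matrix n n ℂ)
    {α : ℝ} (hα0 : 0 ≤ α) (hα : ∀ (c : PBond P (j + 1)) (i : Idx P), dist1 (loopHol V c i) ≤ α) (hα24 : α ≤ 1 / 24) (hN : α < deltaSU n) :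
    ∑ c : PBond P (j + 1),
      ‖(fderiv ℂ (eml : (Idx P → Matrix n n ℂ) → Matrix n n ℂ) (fun i => ((loopHol V c i : Matrix.specialUnitaryGroup n ℂ) : Matrix n n ℂ))
          (fun i => covWalkSum V Z (walk (emb c.src) (loopWord P.L c.dir (off i.1) i.2.1 i.2.2))
            * ((loopHol V c i : Matrix.specialUnitaryGroup n ℂ) : Matrix n n ℂ))
          * star ((corr (expMeanLogSU (n := n)) V c : Matrix.specialUnitaryGroup n ℂ) : Matrix n n ℂ)
        + ((corr (expMeanLogSU (n := n)) V c : Matrix.specialUnitaryGroup n ℂ) : Matrix n n ℂ)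
          * covWalkSum V Z (walk (emb c.src) (List.replicate P.L (c.dir, true)))
          * star ((corr (expMeanLogSU (n := n)) V c : Matrix.specialUnitaryGroup n ℂ) : Matrix n n ℂ))
      - ((((Fintype.card (Idx P) : ℂ))⁻¹ • ∑ i : Idx P, covWalkSum V Z (walk (emb c.src) (stairWord i.2.1 (off i.1))))
          - ((avgFun (expMeanLogSU (n := n)) V c : Matrix.specialUnitaryGroup n ℂ) : Matrix n n ℂ)
              * (((Fintype.card (Idx P) : ℂ))⁻¹ • ∑ i : Idx P, covWalkSum V Z (walk (emb c.tgt) (stairWord i.2.1 (off i.1))))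
              * star ((avgFun (expMeanLogSU (n := n)) V c : Matrix.specialUnitaryGroup n ℂ) : Matrix n n ℂ))
      - ((Fintype.card (Idx P) : ℂ))⁻¹ • ∑ i : Idx P,
          ((holAt V (walk (emb c.src) (stairWord i.2.1 (off i.1))) : Matrix.specialUnitaryGroup n ℂ) : Matrix n n ℂ) *
            covWalkSum V Z (walk (walkEnd (emb c.src) (stairWord i.2.1 (off i.1))) (List.replicate P.L (c.dir, true))) *
          star ((holAt V (walk (emb c.src) (stairWord i.2.1 (off i.1))) : Matrix.specialUnitaryGroup n ℂ) : Matrix n n ℂ)‖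
      ≤ 159 * α * (((P.d + 2) * P.L : ℕ) : ℝ) * (2 * P.d) * ∑ b : PBond P j, ‖Z b‖ := by
  have hK : 0 ≤ 159 * α * (((P.d + 2) * P.L : ℕ) : ℝ) := by positivity
  calc _ ≤ ∑ c : PBond P (j + 1), 159 * α * ((((P.d + 2) * P.L : ℕ) : ℝ)
            * ∑ b ∈ univ.filter (fun b : PBond P j => blockOf b.src = c.src ∨ blockOf b.src = c.tgt), ‖Z b‖) :=
        Finset.sum_le_sum fun c _ => norm_defect_le_nbhd hj V Z c (hα c) hα24 hN
    _ = 159 * α * (((P.d + 2) * P.L : ℕ) : ℝ)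
          * ∑ c : PBond P (j + 1), ∑ b ∈ univ.filter (fun b : PBond P j => blockOf b.src = c.src ∨ blockOf b.src = c.tgt), ‖Z b‖ := by
        rw [Finset.mul_sum]
        exact Finset.sum_congr rfl fun c _ => by ring
    _ ≤ 159 * α * (((P.d + 2) * P.L : ℕ) : ℝ) * (2 * P.d * ∑ b : PBond P j, ‖Z b‖) :=
        mul_le_mul_of_nonneg_left (sum_nbhd_le (fun b => ‖Z b‖) fun b => norm_nonneg _) hK
    _ = _ := by ring

/-! ## §2 The covariant comb mean in `ℓ¹` (combs stay in their block) -/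

omit [Nonempty n] in
/-- The comb of (0.3) from the centre of `B(z)` to the block site of offsets `r` has mass `≤ (d+2)L·Σ_{b : blockOf b₋ = z}‖Z(b)‖` (its bonds issue from `B(z)`,
✓ `blockOf_src_of_mem_walk_stairWord`; its length is `≤ (d+2)L`). [cite: Balaban1987RG1, (0.3) p.252] -/
theorem mass_comb_block_le {j : ℕ} (hj : j + 1 ≤ P.m + P.K) (Z : PBond P j → Matrix n n ℂ) (z : Site P (j + 1)) (σ : Equiv.Perm (Fin P.d))
    (r : Fin P.d → Fin P.L) :
    ((walk (emb z) (stairWord σ (off r))).map fun s => ‖Z s.bond‖).sum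
      ≤ (((P.d + 2) * P.L : ℕ) : ℝ) * ∑ b ∈ univ.filter (fun b : PBond P j => blockOf b.src = z), ‖Z b‖ := by
  have hmem : ∀ s ∈ walk (emb z) (stairWord σ (off r)), s.bond ∈ univ.filter (fun b : PBond P j => blockOf b.src = z) :=
    fun s hs => Finset.mem_filter.2 ⟨Finset.mem_univ _, blockOf_src_of_mem_walk_stairWord hj z σ r s hs⟩
  refine (mass_le_length_mul Z _ _ hmem).trans (mul_le_mul_of_nonneg_right ?_ (Finset.sum_nonneg fun b _ => norm_nonneg _))
  exact_mod_cast length_walk_stairWord_le (emb z) σ r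

/-- The covariant comb mean at a coarse site is bounded by `(d+2)L` times the `ℓ¹` mass of its block: `‖CM_VZ(z)‖ ≤ (d+2)L·Σ_{b : blockOf b₋ = z}‖Z(b)‖`
(norm of the mean ≤ mean of the comb masses, ✓ `norm_covWalkSum_le_mass`). [cite: Balaban1984PropagatorsI, (1.18)-(1.20) pp.19-20] -/
theorem norm_covCombMean_le_block {j : ℕ} (hj : j + 1 ≤ P.m + P.K) (V : GaugeField P j (Matrix.specialUnitaryGroup n ℂ)) (Z : PBond P j → Matrix n n ℂ)
    (z : Site P (j + 1)) :
    ‖((Fintype.card (Idx P) : ℂ))⁻¹ • ∑ i : Idx P, covWalkSum V Z (walk (emb z) (stairWord i.2.1 (off i.1)))‖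
      ≤ (((P.d + 2) * P.L : ℕ) : ℝ) * ∑ b ∈ univ.filter (fun b : PBond P j => blockOf b.src = z), ‖Z b‖ := by
  have hI : (0 : ℝ) < (Fintype.card (Idx P) : ℝ) := by exact_mod_cast Fintype.card_pos
  rw [norm_smul, norm_inv, Complex.norm_natCast]
  calc (Fintype.card (Idx P) : ℝ)⁻¹ * ‖∑ i : Idx P, covWalkSum V Z (walk (emb z) (stairWord i.2.1 (off i.1)))‖
      ≤ (Fintype.card (Idx P) : ℝ)⁻¹ * ∑ _i : Idx P, (((P.d + 2) * P.L : ℕ) : ℝ) * ∑ b ∈ univ.filter (fun b : PBond P j => blockOf b.src = z), ‖Z b‖ :=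
        mul_le_mul_of_nonneg_left ((norm_sum_le _ _).trans (Finset.sum_le_sum fun i _ =>
          (norm_covWalkSum_le_mass V Z _).trans (mass_comb_block_le hj Z z i.2.1 i.1))) (by positivity)
    _ = (((P.d + 2) * P.L : ℕ) : ℝ) * ∑ b ∈ univ.filter (fun b : PBond P j => blockOf b.src = z), ‖Z b‖ := by
        rw [Finset.sum_const, Finset.card_univ, nsmul_eq_mul]
        field_simp

/-- ★ **THE `ℓ¹` ROW OF THE COVARIANT COMB MEAN**: `Σ_z ‖CM_VZ(z)‖ ≤ (d+2)L·Σ_b ‖Z(b)‖` — the blocks partition the fine bonds by their source. [cite: Balaban1984PropagatorsI, (1.18)-(1.20) pp.19-20] -/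
theorem sum_norm_covCombMean_le {j : ℕ} (hj : j + 1 ≤ P.m + P.K) (V : GaugeField P j (Matrix.specialUnitaryGroup n ℂ)) (Z : PBond P j → Matrix n n ℂ) :
    ∑ z : Site P (j + 1), ‖((Fintype.card (Idx P) : ℂ))⁻¹ • ∑ i : Idx P, covWalkSum V Z (walk (emb z) (stairWord i.2.1 (off i.1)))‖
      ≤ (((P.d + 2) * P.L : ℕ) : ℝ) * ∑ b : PBond P j, ‖Z b‖ := by
  calc _ ≤ ∑ z : Site P (j + 1), (((P.d + 2) * P.L : ℕ) : ℝ) * ∑ b ∈ univ.filter (fun b : PBond P j => blockOf b.src = z), ‖Z b‖ :=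
        Finset.sum_le_sum fun z _ => norm_covCombMean_le_block hj V Z z
    _ = (((P.d + 2) * P.L : ℕ) : ℝ) * ∑ b : PBond P j, ‖Z b‖ := by
        rw [← Finset.mul_sum, Finset.sum_fiberwise_of_maps_to (s := Finset.univ) (t := Finset.univ) (g := fun b : PBond P j => blockOf b.src)
          (fun _ _ => Finset.mem_univ _) (fun b : PBond P j => ‖Z b‖)]

/-! ## §3 Real sequences: the sourced contraction with an initial value, and the level sum of the geometric weights -/

omit [Fintype n] [DecidableEq n] [Nonempty n] in
/-- **SOURCED RECURSION WITH AN INITIAL VALUE**: `g (j+1) ≤ (ρ + κ·a j)·g j + r j` (`ρ > 0`, `κ, a j, g j, r j ≥ 0`) ⇒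
`g k ≤ exp((κ/ρ)Σ_{j<k}a j)·(ρᵏ·g 0 + Σ_{j<k} ρ^{k−1−j}·r j)` (twin of ✓ `Prop7TrueLinSourcedDefect.sourced_recursion_bound`, which is the case `g 0 = 0`). [folklore] -/
theorem sourced_recursion_bound_init {ρ κ : ℝ} (hρ : 0 < ρ) (hκ : 0 ≤ κ) (a g r : ℕ → ℝ) (ha : ∀ j, 0 ≤ a j) (hg : ∀ j, 0 ≤ g j) (hr : ∀ j, 0 ≤ r j) :
    ∀ k : ℕ, (∀ j < k, g (j + 1) ≤ (ρ + κ * a j) * g j + r j) →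
      g k ≤ Real.exp (κ / ρ * ∑ j ∈ Finset.range k, a j) * (ρ ^ k * g 0 + ∑ j ∈ Finset.range k, ρ ^ (k - 1 - j) * r j) := by
  intro k
  induction k with
  | zero => intro _; simp
  | succ k ih =>
    intro hgs
    have ihk := ih fun j hj => hgs j (Nat.lt_succ_of_lt hj)
    have hκρ : 0 ≤ κ / ρ := div_nonneg hκ hρ.le
    have hS0 : 0 ≤ ρ ^ k * g 0 + ∑ j ∈ Finset.range k, ρ ^ (k - 1 - j) * r j :=
      add_nonneg (mul_nonneg (pow_nonneg hρ.le _) (hg 0)) (Finset.sum_nonneg fun j _ => mul_nonneg (pow_nonneg hρ.le _) (hr j))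
    have hE1 : 1 ≤ Real.exp (κ / ρ * ∑ j ∈ Finset.range (k + 1), a j) :=
      Real.one_le_exp (mul_nonneg hκρ (Finset.sum_nonneg fun j _ => ha j))
    have hEs : Real.exp (κ / ρ * ∑ j ∈ Finset.range (k + 1), a j) = Real.exp (κ / ρ * ∑ j ∈ Finset.range k, a j) * Real.exp (κ / ρ * a k) := by
      rw [Finset.sum_range_succ, mul_add, Real.exp_add]
    have hstep : ρ + κ * a k ≤ ρ * Real.exp (κ / ρ * a k) := by
      have h1 : 1 + κ / ρ * a k ≤ Real.exp (κ / ρ * a k) := by linarith [Real.add_one_le_exp (κ / ρ * a k)]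
      have h2 : ρ + κ * a k = ρ * (1 + κ / ρ * a k) := by field_simp
      rw [h2]; exact mul_le_mul_of_nonneg_left h1 hρ.le
    -- the weighted sum one level up
    have hSs : ρ ^ (k + 1) * g 0 + ∑ j ∈ Finset.range (k + 1), ρ ^ (k + 1 - 1 - j) * r j
        = ρ * (ρ ^ k * g 0 + ∑ j ∈ Finset.range k, ρ ^ (k - 1 - j) * r j) + r k := by
      rw [Finset.sum_range_succ, mul_add, Finset.mul_sum, show k + 1 - 1 - k = 0 by omega, pow_zero, one_mul, pow_succ]
      have hin : ∑ j ∈ Finset.range k, ρ ^ (k + 1 - 1 - j) * r j = ∑ j ∈ Finset.range k, ρ * (ρ ^ (k - 1 - j) * r j) := by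
        refine Finset.sum_congr rfl fun j hj => ?_
        have hj' := Finset.mem_range.mp hj
        rw [show k + 1 - 1 - j = (k - 1 - j) + 1 by omega, pow_succ]; ring
      rw [hin]; ring
    rw [hSs]
    have hpos : 0 ≤ (ρ + κ * a k) := by have := ha k; positivity
    calc g (k + 1) ≤ (ρ + κ * a k) * g k + r k := hgs k (Nat.lt_succ_self k)
      _ ≤ (ρ * Real.exp (κ / ρ * a k)) * (Real.exp (κ / ρ * ∑ j ∈ Finset.range k, a j) * (ρ ^ k * g 0 + ∑ j ∈ Finset.range k, ρ ^ (k - 1 - j) * r j)) + r k := by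
          have := mul_le_mul hstep ihk (hg k) (by positivity)
          linarith
      _ = Real.exp (κ / ρ * ∑ j ∈ Finset.range (k + 1), a j) * (ρ * (ρ ^ k * g 0 + ∑ j ∈ Finset.range k, ρ ^ (k - 1 - j) * r j)) + r k := by
          rw [hEs]; ring
      _ ≤ Real.exp (κ / ρ * ∑ j ∈ Finset.range (k + 1), a j) * (ρ * (ρ ^ k * g 0 + ∑ j ∈ Finset.range k, ρ ^ (k - 1 - j) * r j) + r k) := by
          have h0 : 0 ≤ r k := hr k
          nlinarith [hE1, h0]

omit [Fintype n] [DecidableEq n] [Nonempty n] in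
/-- **THE LEVEL SUM OF THE GEOMETRIC WEIGHTS**: for `0 ≤ ρ < 1`, `g₀, r j ≥ 0`:
`Σ_{j<k} (ρʲ·g₀ + Σ_{i<j} ρ^{j−1−i}·r i) ≤ (1 − ρ)⁻¹·(g₀ + Σ_{j<k} r j)` — the weights `u_j = ρʲg₀ + Σ_{i<j}ρ^{j−1−i}r_i` obey `u_{j+1} = ρu_j + r_j`, so
`(1−ρ)Σ_{j<k}u_j = u_0 − u_k + Σ_{j<k}r_j`. [folklore] -/
theorem sum_levels_geom_le {ρ : ℝ} (hρ0 : 0 ≤ ρ) (hρ1 : ρ < 1) (g₀ : ℝ) (hg₀ : 0 ≤ g₀) (r : ℕ → ℝ) (hr : ∀ j, 0 ≤ r j) (k : ℕ) :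
    ∑ j ∈ Finset.range k, (ρ ^ j * g₀ + ∑ i ∈ Finset.range j, ρ ^ (j - 1 - i) * r i) ≤ (1 - ρ)⁻¹ * (g₀ + ∑ j ∈ Finset.range k, r j) := by
  -- the exact identity `(1−ρ)·Σ_{j<k} u_j + u_k = g₀ + Σ_{j<k} r_j`
  have hid : ∀ k : ℕ, (1 - ρ) * ∑ j ∈ Finset.range k, (ρ ^ j * g₀ + ∑ i ∈ Finset.range j, ρ ^ (j - 1 - i) * r i)
      + (ρ ^ k * g₀ + ∑ i ∈ Finset.range k, ρ ^ (k - 1 - i) * r i) = g₀ + ∑ j ∈ Finset.range k, r j := by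
    intro k
    induction k with
    | zero => simp
    | succ k ih =>
      have hSs : ρ ^ (k + 1) * g₀ + ∑ i ∈ Finset.range (k + 1), ρ ^ (k + 1 - 1 - i) * r i
          = ρ * (ρ ^ k * g₀ + ∑ i ∈ Finset.range k, ρ ^ (k - 1 - i) * r i) + r k := by
        rw [Finset.sum_range_succ, mul_add, Finset.mul_sum, show k + 1 - 1 - k = 0 by omega, pow_zero, one_mul, pow_succ]
        have hin : ∑ i ∈ Finset.range k, ρ ^ (k + 1 - 1 - i) * r i = ∑ i ∈ Finset.range k, ρ * (ρ ^ (k - 1 - i) * r i) := by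
          refine Finset.sum_congr rfl fun i hi => ?_
          have hi' := Finset.mem_range.mp hi
          rw [show k + 1 - 1 - i = (k - 1 - i) + 1 by omega, pow_succ]; ring
        rw [hin]; ring
      rw [hSs, Finset.sum_range_succ, Finset.sum_range_succ]
      linear_combination ih
  have huk : 0 ≤ ρ ^ k * g₀ + ∑ i ∈ Finset.range k, ρ ^ (k - 1 - i) * r i :=
    add_nonneg (mul_nonneg (pow_nonneg hρ0 _) hg₀) (Finset.sum_nonneg fun i _ => mul_nonneg (pow_nonneg hρ0 _) (hr i))
  have h1ρ : 0 < 1 - ρ := by linarith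
  rw [le_inv_mul_iff₀' h1ρ]
  linarith [hid k]

omit [Fintype n] [DecidableEq n] [Nonempty n] in
/-- **k-UNIFORM READING OF THE GEOMETRIC WEIGHTS**: for `0 ≤ ρ ≤ 1/2`, a nondecreasing `E ≥ 0`, `C, T, g₀, r j ≥ 0` and the weights
`u_j = ρʲg₀ + Σ_{i<j}ρ^{j−1−i}r_i`:  `E_k·u_k + T·Σ_{j<k} C·(E_j·u_j) ≤ (1 + 2TC)·E_k·(g₀ + Σ_{j<k} r_j)` (`u_k ≤ g₀ + Σr`, `Σ_{j<k}u_j ≤ (1−ρ)⁻¹(g₀ + Σr) ≤ 2(g₀ + Σr)`).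
[folklore] -/
theorem geom_weights_uniform {ρ : ℝ} (hρ0 : 0 ≤ ρ) (hρ : ρ ≤ 1 / 2) (E : ℕ → ℝ) (hE0 : ∀ j, 0 ≤ E j) (hEmono : ∀ j k, j ≤ k → E j ≤ E k)
    {C T : ℝ} (hC : 0 ≤ C) (hT : 0 ≤ T) (g₀ : ℝ) (hg₀ : 0 ≤ g₀) (r : ℕ → ℝ) (hr : ∀ j, 0 ≤ r j) (k : ℕ) :
    E k * (ρ ^ k * g₀ + ∑ i ∈ Finset.range k, ρ ^ (k - 1 - i) * r i)
        + T * ∑ j ∈ Finset.range k, C * (E j * (ρ ^ j * g₀ + ∑ i ∈ Finset.range j, ρ ^ (j - 1 - i) * r i))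
      ≤ (1 + 2 * T * C) * E k * (g₀ + ∑ j ∈ Finset.range k, r j) := by
  have hρ1 : ρ ≤ 1 := by linarith
  have hR0 : 0 ≤ g₀ + ∑ j ∈ Finset.range k, r j := add_nonneg hg₀ (Finset.sum_nonneg fun j _ => hr j)
  have hu0 : ∀ j, 0 ≤ ρ ^ j * g₀ + ∑ i ∈ Finset.range j, ρ ^ (j - 1 - i) * r i := fun j =>
    add_nonneg (mul_nonneg (pow_nonneg hρ0 _) hg₀) (Finset.sum_nonneg fun i _ => mul_nonneg (pow_nonneg hρ0 _) (hr i))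
  -- `u_k ≤ g₀ + Σ r`
  have hu : ρ ^ k * g₀ + ∑ i ∈ Finset.range k, ρ ^ (k - 1 - i) * r i ≤ g₀ + ∑ j ∈ Finset.range k, r j := by
    have h1 : ρ ^ k * g₀ ≤ g₀ := by
      have := pow_le_one₀ (n := k) hρ0 hρ1
      nlinarith
    have h2 : ∑ i ∈ Finset.range k, ρ ^ (k - 1 - i) * r i ≤ ∑ j ∈ Finset.range k, r j :=
      Finset.sum_le_sum fun i _ => by
        have := pow_le_one₀ (n := k - 1 - i) hρ0 hρ1
        nlinarith [hr i]
    linarith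
  -- `Σ_{j<k} C·E_j·u_j ≤ C·E_k·2(g₀ + Σ r)`
  have hsum : ∑ j ∈ Finset.range k, C * (E j * (ρ ^ j * g₀ + ∑ i ∈ Finset.range j, ρ ^ (j - 1 - i) * r i))
      ≤ C * E k * (2 * (g₀ + ∑ j ∈ Finset.range k, r j)) := by
    have hle : ∀ j ∈ Finset.range k, C * (E j * (ρ ^ j * g₀ + ∑ i ∈ Finset.range j, ρ ^ (j - 1 - i) * r i))
        ≤ C * E k * (ρ ^ j * g₀ + ∑ i ∈ Finset.range j, ρ ^ (j - 1 - i) * r i) := fun j hj => by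
      have hjk := (Finset.mem_range.mp hj).le
      have h1 := mul_le_mul_of_nonneg_right (hEmono j k hjk) (hu0 j)
      have h2 := mul_le_mul_of_nonneg_left h1 hC
      linarith [h2]
    have h1ρpos : 0 < 1 - ρ := by linarith
    have h1ρ : (1 - ρ)⁻¹ ≤ 2 := by
      rw [inv_le_comm₀ h1ρpos (by norm_num : (0 : ℝ) < 2)]
      linarith
    calc _ ≤ ∑ j ∈ Finset.range k, C * E k * (ρ ^ j * g₀ + ∑ i ∈ Finset.range j, ρ ^ (j - 1 - i) * r i) := Finset.sum_le_sum hle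
      _ = C * E k * ∑ j ∈ Finset.range k, (ρ ^ j * g₀ + ∑ i ∈ Finset.range j, ρ ^ (j - 1 - i) * r i) := by rw [Finset.mul_sum]
      _ ≤ C * E k * ((1 - ρ)⁻¹ * (g₀ + ∑ j ∈ Finset.range k, r j)) :=
          mul_le_mul_of_nonneg_left (sum_levels_geom_le hρ0 (by linarith) g₀ hg₀ r hr k) (mul_nonneg hC (hE0 k))
      _ ≤ C * E k * (2 * (g₀ + ∑ j ∈ Finset.range k, r j)) :=
          mul_le_mul_of_nonneg_left (mul_le_mul_of_nonneg_right h1ρ hR0) (mul_nonneg hC (hE0 k))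
  calc _ ≤ E k * (g₀ + ∑ j ∈ Finset.range k, r j) + T * (C * E k * (2 * (g₀ + ∑ j ∈ Finset.range k, r j))) :=
        add_le_add (mul_le_mul_of_nonneg_left hu (hE0 k)) (mul_le_mul_of_nonneg_left hsum hT)
    _ = (1 + 2 * T * C) * E k * (g₀ + ∑ j ∈ Finset.range k, r j) := by ring

end Summit.QuantumFields.YangMills.Theorems.Prop7TrueLinSourcedDefectL1Rows

end
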